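import Mathlib
import Summits.Ventures.PercRepro2.CoinChainXAClosedGateGen
import Summits.Ventures.PercRepro2.CoinChainReductionGen
import Summits.Ventures.PercRepro2.CoinChainHeadHyps

/-!
# Row 2′DARC at the general AND-switch chain at the CLOSED gate, ANY point markers
(blind cell PercRepro2, night-2 g30)

`darc_of_chain_closed_gate_gen`: the general AND-switch chain (arbitrary sure entries `ent ⊆ U`
and coin entries `ent'`) with the gate head `chainD' ≡ 0` satisfies `DARC pr arcs s {t} m₁ m₂ a w`
for EVERY pair of point markers `m₁, m₂ ∈ U` — no relation between the markers and the entries —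
with an lsm core, positive world masses and ideal mass: `chain_darc_of_functional` with
`chain_functional_nonneg_closed_gate_gen`.
-/

namespace Summit.Ventures.PercRepro2.Coin

open Classical

section ClosedGateGenDarc

variable {V : Type*} {E : Type*} [Fintype V] [DecidableEq V] [Fintype E] [DecidableEq E]
  {R : Type*} [Field R] [LinearOrder R] [IsStrictOrderedRing R]
  {arcs : E → Finset (V × V)} {s : V} {U : Finset V} {ent ent' : Finset V} {c' c : V → E}
  {a' a w : V}

/-- **ROW 2′DARC AT THE GENERAL AND-SWITCH CHAIN AT THE CLOSED GATE, ANY POINT MARKERS**: chain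
data `ν = P(level)`, `c = chainC`, `d = chainD`, the gate head `chainD' ≡ 0`, point markers
`m₁, m₂ ∈ U`, an lsm core, positive world masses and ideal mass: `DARC pr arcs s {t} m₁ m₂ a w`. -/
theorem darc_of_chain_closed_gate_gen (pr : E → R) (hp : IsProbVec pr) (hS : SameEnds arcs)
    (h' : OrTailK arcs s U ent' c' a') (hsure' : ∀ r ∈ ent', pr (c' r) = 1)
    (h : OrTailK arcs s (insert a' U) (insert a' ent) c a) (hsure : ∀ r ∈ ent, pr (c r) = 1)
    (hentU : ent ⊆ U)
    {m₁ m₂ : V} (hm₁ : m₁ ∈ U) (hm₂ : m₂ ∈ U)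
    (hν : ∀ W W', W ⊆ U → W' ⊆ U →
      prob pr (coreLevel arcs s U W) * prob pr (coreLevel arcs s U W') ≤
        prob pr (coreLevel arcs s U (W ∩ W')) * prob pr (coreLevel arcs s U (W ∪ W')))
    {t : V} (htC : t ∉ insert a (insert a' U)) (hts : t ≠ s) (hws : w ≠ s)
    (hwC : w ∉ insert a (insert a' U))
    (h0 : ∀ W, chainD' pr arcs s t U ent' a' a w W = 0)
    (hpos0 : 0 < ∑ W ∈ U.powerset, prob pr (coreLevel arcs s U W) *
      chainMix ent ent' 0 (chainC pr arcs s t U ent' a' a) (chainD pr arcs s t U ent' a' a) W)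
    (hpos1 : 0 < ∑ W ∈ U.powerset, prob pr (coreLevel arcs s U W) *
      chainMix ent ent' 1 (chainC pr arcs s t U ent' a' a) (chainD pr arcs s t U ent' a' a) W)
    (hmI : 0 < ∑ W ∈ U.powerset.filter (fun W => ¬ ∃ r ∈ ent ∪ ent', r ∈ W),
      prob pr (coreLevel arcs s U W) * chainC pr arcs s t U ent' a' a W) :
    DARC pr arcs s {t} m₁ m₂ a w := by
  obtain ⟨hA0, hAmono, hAlsm⟩ := OrTailU.head_props (U := insert a' U) (a := a) pr hp hS t
  obtain ⟨hdc, -, hcc, hdd, -, -, hratio, -, -, hcd, -⟩ :=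
    chainPhi_head_hyps (fun X => prob pr (coreAvoidEvent arcs s t (insert a (insert a' U)) X))
      ent' a' a w hA0 hAmono hAlsm
  have hx0 : ∀ W : Finset V, (0 : R) ≤ (if m₁ ∈ W then (1 : R) else 0) := by
    intro W; split_ifs <;> norm_num
  have hy0 : ∀ W : Finset V, (0 : R) ≤ (if m₂ ∈ W then (1 : R) else 0) := by
    intro W; split_ifs <;> norm_num
  have hx1 : ∀ W : Finset V, (if m₁ ∈ W then (1 : R) else 0) ≤ 1 := by
    intro W; split_ifs <;> norm_num
  have hxm : ∀ s t : Finset V,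
      (if m₁ ∈ s then (1 : R) else 0) ≤ (if m₁ ∈ s ∪ t then (1 : R) else 0) := by
    intro s t
    by_cases h : m₁ ∈ s
    · rw [if_pos h, if_pos (Finset.mem_union_left t h)]
    · rw [if_neg h]; split_ifs <;> norm_num
  have hym : ∀ s t : Finset V,
      (if m₂ ∈ s then (1 : R) else 0) ≤ (if m₂ ∈ s ∪ t then (1 : R) else 0) := by
    intro s t
    by_cases h : m₂ ∈ s
    · rw [if_pos h, if_pos (Finset.mem_union_left t h)]
    · rw [if_neg h]; split_ifs <;> norm_num
  have hD' : chainD' pr arcs s t U ent' a' a w = fun _ => (0 : R) := funext h0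
  refine chain_darc_of_functional pr hS h' hsure' h hsure hentU hm₁ hm₂ htC hts hws hwC ?_
  rw [hD']
  exact chain_functional_nonneg_closed_gate_gen U ent ent' (fun W => prob pr (coreLevel arcs s U W))
    (chainC pr arcs s t U ent' a' a) (chainD pr arcs s t U ent' a' a)
    (pr (c a')) (hp.nonneg _) (hp.le_one _) (fun W => prob_nonneg hp _)
    (fun s' hs' t' ht' => hν s' t' hs' ht') (fun W => hA0 _) (fun W => hA0 _)
    hdc hcc hdd hcd hratio
    (fun W => if m₁ ∈ W then (1 : R) else 0) (fun W => if m₂ ∈ W then (1 : R) else 0)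
    hx0 hy0 hx1 hxm hym hpos0 hpos1 hmI

end ClosedGateGenDarc

end Summit.Ventures.PercRepro2.Coin
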